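import Mathlib
import Literature.MathematicalPhysics.QuantumLattice.WilsonDiracAP
import Summits.QuantumFields.QCD.Theorems.QuarksAsStableActionCriticalLineDiamagnetismStubDeltaBounds
import Summits.QuantumFields.QCD.Theorems.QuarksAsStableActionCriticalLineDiamagnetismStubBlockEstimate
import Summits.QuantumFields.QCD.Theorems.QuarksAsStableActionCriticalLineDiamagnetismStubTadpoleAux

/-!
# Bilinear bounds for the one-loop block functionals (tadpole and bubble)
(helper for crux stmt-QuantumFields-9734, line `Sketch`, stub `stub_bilinearBounds`)

What.  On the `2⁴` block `(ℤ/2)⁴` (colour `Fin 3`, spin `Fin 4`; index type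
`TorusSite 4 2 × Fin 3 × Fin 4`, `192`-dimensional) let `B⁰ = wilsonDirac ρ₃ (fun e => u e.2) m 1`
be the free `r = 1` Wilson–Dirac operator with constant direction-dependent unitary links
`u_μ ∈ U(3)`,
and `Δ(E)` the hopping perturbation, ℝ-linear in the matrix-valued link field `E : Edge 4 2 → M₃(ℂ)`
(forward hop `(1 − γ_μ) ⊗ u_μ E(x,μ)`, backward hop `(1 + γ_μ) ⊗ (u_μ E(y,μ))ᴴ`, prefactor `−½`).
If `B⁰` is coercive, `c₀ Σ_i ‖v_i‖² ≤ Σ_i ‖(B⁰ v)_i‖²` with `c₀ > 0`, then (`stub_bilinearBounds`):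
(a) `Δ(E₁ + E₂) = Δ(E₁) + Δ(E₂)`; (b) `Δ(r • E) = r • Δ(E)` for real `r`;
(c) the bubble form `𝔅(E₁,E₂) = Re tr (B⁰⁻¹ Δ(E₁) B⁰⁻¹ Δ(E₂))` obeys
`|𝔅(E₁,E₂)| ≤ (32/c₀) ‖E₁‖ ‖E₂‖`; (d) the tadpole `ℓ(E) = Re tr (B⁰⁻¹ Δ(E))` obeys
`|ℓ(E)| ≤ (80/√c₀) ‖E‖`, where `‖E‖² = Σ_e Σ_{ab} ‖E_e a b‖²`.

How.  (a), (b): the hopping form `H(C⁺, C⁻)` of the sibling file `…StubTadpoleAux` is additive and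
homogeneous in its colour blocks (`Tadpole.hop_add`, `Tadpole.hop_smul`) and `Δ(E) = H(uE, (uE)ᴴ)`.
(c), (d): `|Re tr (P Q)| ≤ ‖P‖_F ‖Q‖_F` (Cauchy–Schwarz on `Σ_{ij} P_{ij} Q_{ji}`,
`abs_re_trace_mul_le`); coercivity gives `‖B⁰⁻¹ Δ‖_F² ≤ ‖Δ‖_F² / c₀`
(`BlockEstimate.frob_inv_mul_le`) and `Re tr (B⁰⁻¹ Δ) ≤ √(n/c₀) ‖Δ‖_F`
(`StubDetPerturbIRAux.re_trace_inv_mul_le`, applied to `±Δ`, `n = 192`); and the Frobenius sum of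
the hopping kernel is `‖Δ(E)‖_F² ≤ 2 Σ_μ (8 Σ_x ‖u_μ E(x,μ)‖² + 8 Σ_x ‖(u_μ E(x,μ))ᴴ‖²) = 32 ‖E‖²`
(`StubDeltaBounds.frob_kernel_le`, `‖1 ∓ γ_μ‖_F² = 8`, unitary invariance).  Finally
`√(192 · 32) = √6144 ≤ 80`.

Sources.  Montvay–Münster, *Quantum Fields on a Lattice* §4.2 (Wilson fermions, hopping
expansion); folklore finite-dimensional linear algebra.  Pure theorem file (no `def`s); pattern:
siblings `…StubDeltaBounds`, `…StubTadpole`.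
-/

noncomputable section

open scoped BigOperators Classical Matrix ComplexConjugate
open Finset
open Literature.MathematicalPhysics.QuantumLattice Literature.MathematicalPhysics.QuantumFieldTheory
  Literature.Probability.LatticeModels

namespace Summit.QuantumFields.QCD.Cruxes.CriticalLineDiamagnetism.ChessboardCellGain

namespace BilinearBounds

open StubDetPerturbIRAux BlockEstimate

/-! ### Generic linear algebra: traces against Frobenius norms, coercive inverses -/

section Generic

variable {ι : Type} [Fintype ι] [DecidableEq ι]

omit [DecidableEq ι] in
/-- `|Re tr (P Q)| ≤ ‖P‖_F ‖Q‖_F` (Cauchy–Schwarz on `Σ_{ij} P_{ij} Q_{ji}`). -/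
theorem abs_re_trace_mul_le (P Q : Matrix ι ι ℂ) :
    |(P * Q).trace.re| ≤
      Real.sqrt (∑ i, ∑ j, ‖P i j‖ ^ 2) * Real.sqrt (∑ i, ∑ j, ‖Q i j‖ ^ 2) := by
  have hQ : ∑ i, ∑ j, ‖Q i j‖ ^ 2 = ∑ i, ∑ j, ‖Q j i‖ ^ 2 := Finset.sum_comm
  rw [hQ]
  calc |(P * Q).trace.re| ≤ ‖(P * Q).trace‖ := Complex.abs_re_le_norm _
    _ = ‖∑ i, ∑ j, P i j * Q j i‖ := by simp only [Matrix.trace, Matrix.diag, Matrix.mul_apply]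
    _ ≤ ∑ i, ∑ j, ‖P i j‖ * ‖Q j i‖ :=
        (norm_sum_le _ _).trans (Finset.sum_le_sum fun i _ => (norm_sum_le _ _).trans
          (le_of_eq (Finset.sum_congr rfl fun j _ => norm_mul _ _)))
    _ ≤ Real.sqrt (∑ i, ∑ j, ‖P i j‖ ^ 2) * Real.sqrt (∑ i, ∑ j, ‖Q j i‖ ^ 2) := by
        rw [← Fintype.sum_prod_type', ← Fintype.sum_prod_type', ← Fintype.sum_prod_type']
        exact Real.sum_mul_le_sqrt_mul_sqrt _ _ _

/-- **Bubble bound.**  For coercive `B` (`c Σ‖v_i‖² ≤ Σ‖(Bv)_i‖²`, `c > 0`) and perturbations with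
`‖Δ_k‖_F² ≤ 32 S_k`: `|Re tr (B⁻¹ Δ₁ B⁻¹ Δ₂)| ≤ (32/c) √S₁ √S₂`. -/
theorem abs_re_trace_bubble_le (B Δ₁ Δ₂ : Matrix ι ι ℂ) {c S₁ S₂ : ℝ} (hc : 0 < c)
    (hB : ∀ v : ι → ℂ, c * ∑ i, ‖v i‖ ^ 2 ≤ ∑ i, ‖(B.mulVec v) i‖ ^ 2)
    (h₁ : ∑ i, ∑ j, ‖Δ₁ i j‖ ^ 2 ≤ 32 * S₁) (h₂ : ∑ i, ∑ j, ‖Δ₂ i j‖ ^ 2 ≤ 32 * S₂) :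
    |(B⁻¹ * Δ₁ * (B⁻¹ * Δ₂)).trace.re| ≤ 32 / c * Real.sqrt S₁ * Real.sqrt S₂ := by
  have hP : ∑ i, ∑ j, ‖(B⁻¹ * Δ₁) i j‖ ^ 2 ≤ 32 / c * S₁ :=
    (frob_inv_mul_le B Δ₁ hc hB).trans
      ((div_le_div_of_nonneg_right h₁ hc.le).trans_eq (by ring))
  have hQ : ∑ i, ∑ j, ‖(B⁻¹ * Δ₂) i j‖ ^ 2 ≤ 32 / c * S₂ :=
    (frob_inv_mul_le B Δ₂ hc hB).trans
      ((div_le_div_of_nonneg_right h₂ hc.le).trans_eq (by ring))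
  have h32 : (0 : ℝ) ≤ 32 / c := by positivity
  calc |(B⁻¹ * Δ₁ * (B⁻¹ * Δ₂)).trace.re|
      ≤ Real.sqrt (∑ i, ∑ j, ‖(B⁻¹ * Δ₁) i j‖ ^ 2) *
          Real.sqrt (∑ i, ∑ j, ‖(B⁻¹ * Δ₂) i j‖ ^ 2) := abs_re_trace_mul_le _ _
    _ ≤ Real.sqrt (32 / c * S₁) * Real.sqrt (32 / c * S₂) :=
        mul_le_mul (Real.sqrt_le_sqrt hP) (Real.sqrt_le_sqrt hQ) (Real.sqrt_nonneg _)
          (Real.sqrt_nonneg _)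
    _ = Real.sqrt (32 / c) * Real.sqrt (32 / c) * Real.sqrt S₁ * Real.sqrt S₂ := by
        rw [Real.sqrt_mul h32, Real.sqrt_mul h32]; ring
    _ = 32 / c * Real.sqrt S₁ * Real.sqrt S₂ := by rw [Real.mul_self_sqrt h32]

/-- **Tadpole bound.**  For coercive `B` on a `192`-dimensional space and `‖Δ‖_F² ≤ 32 S`:
`|Re tr (B⁻¹ Δ)| ≤ (80/√c) √S` (`Re tr (B⁻¹ (±Δ)) ≤ √(192/c) ‖Δ‖_F` and `√(192 · 32) ≤ 80`). -/
theorem abs_re_trace_inv_mul_le (B Δ : Matrix ι ι ℂ) {c S : ℝ} (hc : 0 < c)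
    (hB : ∀ v : ι → ℂ, c * ∑ i, ‖v i‖ ^ 2 ≤ ∑ i, ‖(B.mulVec v) i‖ ^ 2)
    (hn : (Fintype.card ι : ℝ) = 192) (h : ∑ i, ∑ j, ‖Δ i j‖ ^ 2 ≤ 32 * S) :
    |(B⁻¹ * Δ).trace.re| ≤ 80 / Real.sqrt c * Real.sqrt S := by
  have h1 := re_trace_inv_mul_le B Δ hc hB
  have h2 := re_trace_inv_mul_le B (-Δ) hc hB
  rw [Matrix.mul_neg, Matrix.trace_neg, Complex.neg_re] at h2
  simp only [Matrix.neg_apply, norm_neg] at h2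
  rw [hn] at h1 h2
  have h80 : Real.sqrt 192 * Real.sqrt 32 ≤ 80 := by
    rw [← Real.sqrt_mul (by norm_num : (0 : ℝ) ≤ 192)]
    exact (Real.sqrt_le_sqrt (by norm_num : (192 : ℝ) * 32 ≤ 80 ^ 2)).trans_eq
      (Real.sqrt_sq (by norm_num))
  calc |(B⁻¹ * Δ).trace.re|
      ≤ Real.sqrt (192 / c) * Real.sqrt (∑ i, ∑ j, ‖Δ i j‖ ^ 2) := abs_le.mpr ⟨by linarith, h1⟩
    _ ≤ Real.sqrt (192 / c) * Real.sqrt (32 * S) :=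
        mul_le_mul_of_nonneg_left (Real.sqrt_le_sqrt h) (Real.sqrt_nonneg _)
    _ = Real.sqrt 192 * Real.sqrt 32 * (Real.sqrt S / Real.sqrt c) := by
        rw [Real.sqrt_div' 192 hc.le, Real.sqrt_mul (by norm_num : (0 : ℝ) ≤ 32)]; ring
    _ ≤ 80 * (Real.sqrt S / Real.sqrt c) := mul_le_mul_of_nonneg_right h80 (by positivity)
    _ = 80 / Real.sqrt c * Real.sqrt S := by ring

end Generic

/-! ### The block: index count, real scalars, Frobenius sum of the hopping form -/

/-- The block index type `(ℤ/2)⁴ × colour × spin` has `16 · 3 · 4 = 192` elements. -/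
theorem card_index : (Fintype.card (TorusSite 4 2 × Fin 3 × Fin 4) : ℝ) = 192 := by
  norm_num [Fintype.card_prod, Fintype.card_fin, ZMod.card, Fintype.card_fun]

/-- Real scalars act on complex `3 × 3` matrices through the coercion `ℝ → ℂ`. -/
theorem real_smul_eq (r : ℝ) (M : Matrix (Fin 3) (Fin 3) ℂ) : r • M = (r : ℂ) • M := by
  ext a b
  simp only [Matrix.smul_apply, Complex.real_smul, smul_eq_mul]

/-- The Frobenius sum is invariant under the conjugate transpose (`3 × 3`). -/
theorem sum_norm_sq_conjTranspose (M : Matrix (Fin 3) (Fin 3) ℂ) :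
    ∑ a, ∑ b, ‖Mᴴ a b‖ ^ 2 = ∑ a, ∑ b, ‖M a b‖ ^ 2 :=
  StubDeltaBounds.sum_norm_sq_star M

/-- Link sums: `Σ_e = Σ_μ Σ_x` on `Edge 4 2 = TorusSite 4 2 × Fin 4`. -/
theorem sum_edge_eq (E : Edge 4 2 → Matrix (Fin 3) (Fin 3) ℂ) :
    ∑ e, ∑ a, ∑ b, ‖E e a b‖ ^ 2 =
      ∑ μ : Fin 4, ∑ x : TorusSite 4 2, ∑ a, ∑ b, ‖E (x, μ) a b‖ ^ 2 := by
  rw [Fintype.sum_prod_type, Finset.sum_comm]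

/-- **Frobenius sum of the hopping form.**  With the hopping form `H(C⁺, C⁻)` of `…StubTadpoleAux`
(defining equation `hH`): `‖H(C⁺, C⁻)‖_F² ≤ 2 Σ_μ (8 Σ_x ‖C⁺_μ(x)‖_F² + 8 Σ_x ‖C⁻_μ(x)‖_F²)`
(`StubDeltaBounds.frob_kernel_le` with `‖1 ∓ γ_μ‖_F² = 8`). -/
theorem hop_frob_le
    {H : (Fin 4 → TorusSite 4 2 → Matrix (Fin 3) (Fin 3) ℂ) →
      (Fin 4 → TorusSite 4 2 → Matrix (Fin 3) (Fin 3) ℂ) →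
        Matrix (TorusSite 4 2 × Fin 3 × Fin 4) (TorusSite 4 2 × Fin 3 × Fin 4) ℂ}
    (hH : ∀ Cp Cm, H Cp Cm = Matrix.of fun p q : TorusSite 4 2 × Fin 3 × Fin 4 =>
      -(1 / 2 : ℂ) * ∑ μ : Fin 4,
        ((if q.1 = Literature.MathematicalPhysics.QuantumFieldTheory.Site.shift p.1 μ then
            ((1 : Matrix (Fin 4) (Fin 4) ℂ) - euclideanGamma μ) p.2.2 q.2.2 * Cp μ p.1 p.2.1 q.2.1
          else 0) +
          (if p.1 = Literature.MathematicalPhysics.QuantumFieldTheory.Site.shift q.1 μ then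
            ((1 : Matrix (Fin 4) (Fin 4) ℂ) + euclideanGamma μ) p.2.2 q.2.2 * Cm μ q.1 p.2.1 q.2.1
          else 0)))
    (Cp Cm : Fin 4 → TorusSite 4 2 → Matrix (Fin 3) (Fin 3) ℂ) :
    ∑ p, ∑ q, ‖H Cp Cm p q‖ ^ 2 ≤
      2 * ∑ μ, ((8 : ℝ) * ∑ x, ∑ a, ∑ b, ‖Cp μ x a b‖ ^ 2 +
        8 * ∑ x, ∑ a, ∑ b, ‖Cm μ x a b‖ ^ 2) := by
  have h := StubDeltaBounds.frob_kernel_le (L := 2)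
    (fun μ => (1 : Matrix (Fin 4) (Fin 4) ℂ) - euclideanGamma μ)
    (fun μ => (1 : Matrix (Fin 4) (Fin 4) ℂ) + euclideanGamma μ) Cp Cm
  simp only [StubDeltaBounds.sum_norm_sq_one_sub_gamma,
    StubDeltaBounds.sum_norm_sq_one_add_gamma] at h
  simpa only [hH, Matrix.of_apply] using h

end BilinearBounds

open BilinearBounds in
/-- **Stub Bd — `bilinearBounds`.**  On the `2⁴` block, with
`B⁰ = wilsonDirac ρ₃ (fun e => u e.2) m 1` (constant direction-dependent unitary links) and the
hopping perturbation `Δ(E)` (ℝ-linear in the link field `E : Edge 4 2 → M₃(ℂ)`): if `B⁰` is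
coercive with constant `c₀ > 0`, then
(a) `Δ(E₁ + E₂) = Δ(E₁) + Δ(E₂)`, (b) `Δ(r • E) = r • Δ(E)` (`r` real),
(c) `|Re tr (B⁰⁻¹Δ(E₁)B⁰⁻¹Δ(E₂))| ≤ (32/c₀) ‖E₁‖ ‖E₂‖`, (d) `|Re tr (B⁰⁻¹Δ(E))| ≤ (80/√c₀) ‖E‖`.
Proof: `Tadpole.hop_add/hop_smul`; `|Re tr (PQ)| ≤ ‖P‖_F‖Q‖_F`, `‖B⁰⁻¹Δ‖_F² ≤ ‖Δ‖_F²/c₀`,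
`Re tr (B⁰⁻¹(±Δ)) ≤ √(192/c₀)‖Δ‖_F`, and `‖Δ(E)‖_F² ≤ 32‖E‖²` (`BilinearBounds.hop_frob_le`). -/
theorem stub_bilinearBounds : ∀ (m : ℝ) (u : Fin 4 → Matrix.unitaryGroup (Fin 3) ℂ) (c₀ : ℝ), 0 < c₀ → let B0 : Matrix (TorusSite 4 2 × Fin 3 × Fin 4) (TorusSite 4 2 × Fin 3 × Fin 4) ℂ := wilsonDirac (unitaryFundamentalRep (Fin 3) ℂ) (fun e : Edge 4 2 => u e.2) m 1; let Dl : (Edge 4 2 → Matrix (Fin 3) (Fin 3) ℂ) → Matrix (TorusSite 4 2 × Fin 3 × Fin 4) (TorusSite 4 2 × Fin 3 × Fin 4) ℂ := fun E => Matrix.of fun p q => -(1 / 2 : ℂ) * ∑ μ : Fin 4, ((if q.1 = Site.shift p.1 μ then ((1 : Matrix (Fin 4) (Fin 4) ℂ) - euclideanGamma μ) p.2.2 q.2.2 * (((u μ : Matrix.unitaryGroup (Fin 3) ℂ) : Matrix (Fin 3) (Fin 3) ℂ) * E (p.1, μ)) p.2.1 q.2.1 else 0) + (if p.1 = Site.shift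 q.1 μ then ((1 : Matrix (Fin 4) (Fin 4) ℂ) + euclideanGamma μ) p.2.2 q.2.2 * (((u μ : Matrix.unitaryGroup (Fin 3) ℂ) : Matrix (Fin 3) (Fin 3) ℂ) * E (q.1, μ))ᴴ p.2.1 q.2.1 else 0)); let ell : (Edge 4 2 → Matrix (Fin 3) (Fin 3) ℂ) → ℝ := fun E => (B0⁻¹ * Dl E).trace.re; let bf : (Edge 4 2 → Matrix (Fin 3) (Fin 3) ℂ) → (Edge 4 2 → Matrix (Fin 3) (Fin 3) ℂ) → ℝ := fun E₁ E₂ => (B0⁻¹ * Dl E₁ * (B0⁻¹ * Dl E₂)).trace.re; (∀ v : TorusSite 4 2 × Fin 3 × Fin 4 → ℂ, c₀ * ∑ i, ‖v i‖ ^ 2 ≤ ∑ i, ‖(B0.mulVec v) i‖ ^ 2) → (∀ E₁ E₂ : Edge 4 2 → Matrix (Fin 3) (Fin 3) ℂ, Dl (E₁ + E₂) = Dl E₁ + Dl E₂) ∧ (∀ (r : ℝ) (E : Edge 4 2 → Matrix (Fin 3) (Fin 3) ℂ), Dl (r • E) = (r : ℂ) • Dl E) ∧ (∀ E₁ E₂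 : Edge 4 2 → Matrix (Fin 3) (Fin 3) ℂ, |bf E₁ E₂| ≤ 32 / c₀ * Real.sqrt (∑ e, ∑ a, ∑ b, ‖E₁ e a b‖ ^ 2) * Real.sqrt (∑ e, ∑ a, ∑ b, ‖E₂ e a b‖ ^ 2)) ∧ (∀ E : Edge 4 2 → Matrix (Fin 3) (Fin 3) ℂ, |ell E| ≤ 80 / Real.sqrt c₀ * Real.sqrt (∑ e, ∑ a, ∑ b, ‖E e a b‖ ^ 2)) := by
  intro m u c₀ hc₀ B0 Dl ell bf hB
  -- the hopping form `H`: `Δ(E) = H(uE, (uE)ᴴ)`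
  obtain ⟨H, hH⟩ : ∃ H : (Fin 4 → TorusSite 4 2 → Matrix (Fin 3) (Fin 3) ℂ) →
      (Fin 4 → TorusSite 4 2 → Matrix (Fin 3) (Fin 3) ℂ) →
        Matrix (TorusSite 4 2 × Fin 3 × Fin 4) (TorusSite 4 2 × Fin 3 × Fin 4) ℂ,
      ∀ Cp Cm, H Cp Cm = Matrix.of fun p q : TorusSite 4 2 × Fin 3 × Fin 4 =>
        -(1 / 2 : ℂ) * ∑ μ : Fin 4,
          ((if q.1 = Literature.MathematicalPhysics.QuantumFieldTheory.Site.shift p.1 μ then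
              ((1 : Matrix (Fin 4) (Fin 4) ℂ) - euclideanGamma μ) p.2.2 q.2.2 * Cp μ p.1 p.2.1 q.2.1
            else 0) +
            (if p.1 = Literature.MathematicalPhysics.QuantumFieldTheory.Site.shift q.1 μ then
              ((1 : Matrix (Fin 4) (Fin 4) ℂ) + euclideanGamma μ) p.2.2 q.2.2 * Cm μ q.1 p.2.1 q.2.1
            else 0)) :=
    ⟨_, fun _ _ => rfl⟩
  have hDl : ∀ E' : Edge 4 2 → Matrix (Fin 3) (Fin 3) ℂ,
      Dl E' = H (fun μ x => (u μ : Matrix (Fin 3) (Fin 3) ℂ) * E' (x, μ))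
        (fun μ y => ((u μ : Matrix (Fin 3) (Fin 3) ℂ) * E' (y, μ))ᴴ) := fun E' => by
    rw [hH]
  -- the Frobenius bound `‖Δ(E)‖_F² ≤ 32 ‖E‖²`
  have hF : ∀ E' : Edge 4 2 → Matrix (Fin 3) (Fin 3) ℂ,
      ∑ p, ∑ q, ‖Dl E' p q‖ ^ 2 ≤ 32 * ∑ e, ∑ a, ∑ b, ‖E' e a b‖ ^ 2 := fun E' => by
    rw [hDl]
    refine (hop_frob_le hH _ _).trans (le_of_eq ?_)
    simp only [sum_norm_sq_conjTranspose, StubDeltaBounds.sum_norm_sq_unitary_mul]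
    rw [sum_edge_eq E', Finset.mul_sum _ _ (2 : ℝ), Finset.mul_sum _ _ (32 : ℝ)]
    exact Finset.sum_congr rfl fun μ _ => by ring
  have hell : ∀ E' : Edge 4 2 → Matrix (Fin 3) (Fin 3) ℂ, ell E' = (B0⁻¹ * Dl E').trace.re :=
    fun _ => rfl
  have hbf : ∀ E₁ E₂ : Edge 4 2 → Matrix (Fin 3) (Fin 3) ℂ,
      bf E₁ E₂ = (B0⁻¹ * Dl E₁ * (B0⁻¹ * Dl E₂)).trace.re := fun _ _ => rfl
  refine ⟨fun E₁ E₂ => ?_, fun r E => ?_, fun E₁ E₂ => ?_, fun E => ?_⟩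
  · -- (a) additivity
    have h1 : (fun μ x => (u μ : Matrix (Fin 3) (Fin 3) ℂ) * (E₁ + E₂) (x, μ)) =
        (fun μ x => (u μ : Matrix (Fin 3) (Fin 3) ℂ) * E₁ (x, μ)) +
          fun μ x => (u μ : Matrix (Fin 3) (Fin 3) ℂ) * E₂ (x, μ) := by
      funext μ x; simp [Matrix.mul_add]
    have h2 : (fun μ y => ((u μ : Matrix (Fin 3) (Fin 3) ℂ) * (E₁ + E₂) (y, μ))ᴴ) =
        (fun μ y => ((u μ : Matrix (Fin 3) (Fin 3) ℂ) * E₁ (y, μ))ᴴ) +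
          fun μ y => ((u μ : Matrix (Fin 3) (Fin 3) ℂ) * E₂ (y, μ))ᴴ := by
      funext μ y; simp [Matrix.mul_add, Matrix.conjTranspose_add]
    rw [hDl, hDl, hDl, h1, h2, Tadpole.hop_add hH]
  · -- (b) real homogeneity
    have h1 : (fun μ x => (u μ : Matrix (Fin 3) (Fin 3) ℂ) * (r • E) (x, μ)) =
        (r : ℂ) • fun μ x => (u μ : Matrix (Fin 3) (Fin 3) ℂ) * E (x, μ) := by
      funext μ x
      simp only [Pi.smul_apply, real_smul_eq, Matrix.mul_smul]
    have h2 : (fun μ y => ((u μ : Matrix (Fin 3) (Fin 3) ℂ) * (r • E) (y, μ))ᴴ) =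
        (r : ℂ) • fun μ y => ((u μ : Matrix (Fin 3) (Fin 3) ℂ) * E (y, μ))ᴴ := by
      funext μ y
      simp only [Pi.smul_apply, real_smul_eq, Matrix.mul_smul, Matrix.conjTranspose_smul,
        Complex.star_def, Complex.conj_ofReal]
    rw [hDl, hDl, h1, h2, Tadpole.hop_smul hH]
  · -- (c) the bubble
    rw [hbf]
    exact abs_re_trace_bubble_le B0 (Dl E₁) (Dl E₂) hc₀ hB (hF E₁) (hF E₂)
  · -- (d) the tadpole
    rw [hell]
    exact abs_re_trace_inv_mul_le B0 (Dl E) hc₀ hB card_index (hF E)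

end Summit.QuantumFields.QCD.Cruxes.CriticalLineDiamagnetism.ChessboardCellGain

end
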